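import Summits.Ventures.YMGap.RobustBall.FreeEnergyStrongConvexity
import Summits.Ventures.YMGap.RobustBall.FreeEnergyLawDerivative
import HarnessLib

/-!
# Robust ball (Y2), strong-coupling laws — on every finite torus the mean plaquette is STRICTLY increasing in the coupling, at EVERY
# coupling, with a volume-independent rate

HONEST FRAMING: venture file of the cell `pub-ymgap` (QuantumFields programme), track ROBUST-BALL, seat rb-p2 (g8).  FINITE-VOLUME LATTICE
statements about the torus Wilson states `μ_{Λ_{L+1},β}` of a special unitary model (`G ≅ SU(N)`, `N ≥ 2`, `d ≥ 2`, torus side `L + 1 ≥ 2`,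
tree coupling `β ∈ ℝ`): no window, no uniqueness input, no infinite-volume limit.  Nothing about the continuum, a spectral gap or Clay; the rate
is a one-link artefact.

MECHANISM.  The torus pressure `p_L(t) = |Λ|⁻¹ log Z_{Λ,t}` is smooth with `p_L'(t) = Σ_{i<j} ⟨Re tr ρ(U_{(0,i,j)})⟩_{Λ,t} − #planes·N`
(rb-p2 g7 `FreeEnergyLaw.hasDerivAt_torusPressure`) and `p_L − (m_L(b)/2)t²` is convex on `[−b, b]` (`convexOn_torusPressure_sub_sq`, the
energy-variance floor), so the plane sum of plaquette expectations increases at rate `≥ m_L(b) ≥ 2^{−d} e^{−8(d−1)Nb} V₀` there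
(checkerboard density `≥ 2^{−d}`); every single plaquette carries `1/#planes` of the plane sum (`wilsonExpectation_plaquette_eq_planeSum_div`).

* ★★ `planeSum_increment_ge` / `plaquette_increment_ge` — for `−b ≤ x < y ≤ b`:
  `⟨Re tr ρ(U_p)⟩_{Λ,y} − ⟨Re tr ρ(U_p)⟩_{Λ,x} ≥ 2^{−d} e^{−8(d−1)Nb} V₀ (y − x) / #planes` for EVERY plaquette `p`, EVERY `L ≥ 1`;
* ★★ `strictMono_torusPlaquette` — `β ↦ ⟨Re tr ρ(U_p)⟩_{Λ_{L+1},β}` is STRICTLY increasing on all of `ℝ`;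
* `su2_torusPlaquette_increment_ge_dim4` — `SU(2)`, `d = 4`: rate `e^{−48b}/96` per plaquette (tree coupling).

References: S. Friedli, Y. Velenik (2017) §3.2; E. Seiler, LNP 159 (1982) Ch. 2.  Everything here is proved. [folklore]
-/

noncomputable section

open MeasureTheory ProbabilityTheory Finset Function Filter Topology Set
open Literature.MathematicalPhysics.QuantumLattice Literature.MathematicalPhysics.QuantumFieldTheory

namespace Summit.Ventures.YMGap.RobustBall

namespace EnergyVariance

variable {d N : ℕ} {G : Type*} [Group G] [TopologicalSpace G] [IsTopologicalGroup G] [CompactSpace G]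
  [MeasurableSpace G] [BorelSpace G] [SecondCountableTopology G] (ρ : G →* Matrix (Fin N) (Fin N) ℂ)

/-- The checkerboard density is `≥ 2^{−d}` for `L ≥ 1`: `|Λ_{L+1}|⁻¹ · (n(n−1)^{d−1}/2) ≥ (1/2)^d`, `n = L + 1` (`parity_density_ge`). [folklore] -/
theorem sparse_density_ge (hd : 1 ≤ d) {L : ℕ} (hL : 1 ≤ L) :
    (1 / 2 : ℝ) ^ d ≤ (((L + 1 : ℕ) : ℝ) ^ d)⁻¹ * (((L + 1 : ℕ) : ℝ) * (((L + 1 : ℕ) : ℝ) - 1) ^ (d - 1) / 2) := by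
  have h := parity_density_ge hd hL
  have hn : (((L + 1 : ℕ) : ℝ) ^ d) ≠ 0 := by positivity
  have e : (((L + 1 : ℕ) : ℝ) * (((L + 1 : ℕ) : ℝ) - 1) ^ (d - 1)) / (2 * ((L + 1 : ℕ) : ℝ) ^ d) =
      (((L + 1 : ℕ) : ℝ) ^ d)⁻¹ * (((L + 1 : ℕ) : ℝ) * (((L + 1 : ℕ) : ℝ) - 1) ^ (d - 1) / 2) := by
    field_simp
  rw [e] at h
  exact h

/-- ★★ **The plane sum of torus plaquette expectations increases at a definite rate, at every coupling.**  `G ≅ SU(N)`, `N ≥ 2`, `d ≥ 2`,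
`L ≥ 1`: for `−b ≤ x < y ≤ b`,
`Σ_{i<j} ⟨Re tr ρ(U_{(0,i,j)})⟩_{Λ_{L+1},y} − Σ_{i<j} ⟨Re tr ρ(U_{(0,i,j)})⟩_{Λ_{L+1},x} ≥ 2^{−d} e^{−8(d−1)Nb} V₀ · (y − x)`. [folklore] -/
theorem planeSum_increment_ge (hρ : IsSpecialUnitaryModel ρ) (hN : 2 ≤ N) (hd : 2 ≤ d) {L : ℕ} (hL : 1 ≤ L) {b x y : ℝ}
    (hx : x ∈ Set.Icc (-b) b) (hy : y ∈ Set.Icc (-b) b) (hxy : x < y) :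
    (1 / 2 : ℝ) ^ d * Real.exp (-(8 * (d - 1 : ℕ) * N * b)) * PlaquetteLowerBound.charVariance ρ * (y - x) ≤
      (∑ q : {q : Fin d × Fin d // q.1 < q.2}, wilsonExpectation (L := L + 1) ρ y
          (toTorusObservable (L + 1) (plaquetteObs ρ (0 : Literature.Probability.LatticeModels.Site d) q.1.1 q.1.2))) -
        ∑ q : {q : Fin d × Fin d // q.1 < q.2}, wilsonExpectation (L := L + 1) ρ x
          (toTorusObservable (L + 1) (plaquetteObs ρ (0 : Literature.Probability.LatticeModels.Site d) q.1.1 q.1.2)) := by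
  set mL : ℝ := (((L + 1 : ℕ) : ℝ) ^ d)⁻¹ * ((((L + 1 : ℕ) : ℝ) * (((L + 1 : ℕ) : ℝ) - 1) ^ (d - 1) / 2) *
      Real.exp (-(8 * (d - 1 : ℕ) * N * b)) * PlaquetteLowerBound.charVariance ρ) with hmL
  set P : ℝ → ℝ := fun s => ∑ q : {q : Fin d × Fin d // q.1 < q.2}, wilsonExpectation (L := L + 1) ρ s
      (toTorusObservable (L + 1) (plaquetteObs ρ (0 : Literature.Probability.LatticeModels.Site d) q.1.1 q.1.2)) with hP
  set c : ℝ := (Fintype.card {q : Fin d × Fin d // q.1 < q.2} : ℝ) * N with hc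
  -- the torus pressure, written as a normalised cumulant generating function
  have hconv := convexOn_torusPressure_sub_sq ρ hρ hN hd hL b
  have hfun : (fun t : ℝ => (((L + 1 : ℕ) : ℝ) ^ d)⁻¹ *
      cgf (fun U : GaugeConfig d (L + 1) G => -wilsonAction ρ U) (Measure.pi fun _ : Edge d (L + 1) => haarProbability G) t) =
      fun t : ℝ => (((L + 1 : ℕ) : ℝ) ^ d)⁻¹ * torusLogPartition d ρ t (L + 1) := by
    funext t; rw [torusLogPartition_eq_cgf ρ hρ.1 t]
  have hderiv : ∀ t, HasDerivAt (fun t : ℝ => (((L + 1 : ℕ) : ℝ) ^ d)⁻¹ *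
      cgf (fun U : GaugeConfig d (L + 1) G => -wilsonAction ρ U) (Measure.pi fun _ : Edge d (L + 1) => haarProbability G) t -
        mL / 2 * t ^ 2) (P t - c - mL * t) t := by
    intro t
    have h := FreeEnergyLaw.hasDerivAt_torusPressure (d := d) (G := G) ρ hρ.1 L t
    rw [← hfun] at h
    exact h.fun_sub (hasDerivAt_half_mul_sq mL t)
  have h1 := hconv.le_slope_of_hasDerivAt hx hy hxy (hderiv x)
  have h2 := hconv.slope_le_of_hasDerivAt hx hy hxy (hderiv y)
  have h12 : mL * (y - x) ≤ P y - P x := by nlinarith [h1.trans h2, hxy]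
  -- the uniform rate
  have hdens := sparse_density_ge (d := d) (by omega) hL
  have hK : 0 ≤ Real.exp (-(8 * (d - 1 : ℕ) * N * b)) * PlaquetteLowerBound.charVariance ρ :=
    mul_nonneg (Real.exp_pos _).le (PlaquetteLowerBound.charVariance_pos ρ hρ.1 (by omega)).le
  have hm : (1 / 2 : ℝ) ^ d * Real.exp (-(8 * (d - 1 : ℕ) * N * b)) * PlaquetteLowerBound.charVariance ρ ≤ mL := by
    have := mul_le_mul_of_nonneg_right hdens hK
    simp only [hmL]
    linarith [this]
  calc (1 / 2 : ℝ) ^ d * Real.exp (-(8 * (d - 1 : ℕ) * N * b)) * PlaquetteLowerBound.charVariance ρ * (y - x)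
      ≤ mL * (y - x) := mul_le_mul_of_nonneg_right hm (sub_pos.2 hxy).le
    _ ≤ P y - P x := h12

/-- ★★ **EVERY torus plaquette expectation increases at a definite rate, at every coupling**: `G ≅ SU(N)`, `N ≥ 2`, `d ≥ 2`, `L ≥ 1`, every
site `x₀`, axes `i ≠ j`, `−b ≤ x < y ≤ b`:
`⟨Re tr ρ(U_{x₀,ij})⟩_{Λ_{L+1},y} − ⟨Re tr ρ(U_{x₀,ij})⟩_{Λ_{L+1},x} ≥ 2^{−d} e^{−8(d−1)Nb} V₀ (y − x) / #planes`. [folklore] -/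
theorem plaquette_increment_ge (hρ : IsSpecialUnitaryModel ρ) (hN : 2 ≤ N) (hd : 2 ≤ d) {L : ℕ} (hL : 1 ≤ L) (x₀ : Site d (L + 1))
    {i j : Fin d} (hij : i ≠ j) {b x y : ℝ} (hx : x ∈ Set.Icc (-b) b) (hy : y ∈ Set.Icc (-b) b) (hxy : x < y) :
    (1 / 2 : ℝ) ^ d * Real.exp (-(8 * (d - 1 : ℕ) * N * b)) * PlaquetteLowerBound.charVariance ρ * (y - x) /
        (Fintype.card {q : Fin d × Fin d // q.1 < q.2} : ℝ) ≤
      wilsonExpectation (L := L + 1) ρ y (fun U : GaugeConfig d (L + 1) G => (ρ (plaquetteHolonomy U x₀ i j)).trace.re) -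
        wilsonExpectation (L := L + 1) ρ x (fun U : GaugeConfig d (L + 1) G => (ρ (plaquetteHolonomy U x₀ i j)).trace.re) := by
  have hD : (0 : ℝ) < (Fintype.card {q : Fin d × Fin d // q.1 < q.2} : ℝ) := by
    have h01 : (⟨0, by omega⟩ : Fin d) < ⟨1, by omega⟩ := Fin.mk_lt_mk.2 (by norm_num)
    have : 0 < Fintype.card {q : Fin d × Fin d // q.1 < q.2} := Fintype.card_pos_iff.2 ⟨⟨(⟨0, by omega⟩, ⟨1, by omega⟩), h01⟩⟩
    exact_mod_cast this
  rw [FreeEnergyLaw.wilsonExpectation_plaquette_eq_planeSum_div ρ hρ.1 hd y L x₀ hij,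
    FreeEnergyLaw.wilsonExpectation_plaquette_eq_planeSum_div ρ hρ.1 hd x L x₀ hij, ← sub_div]
  exact div_le_div_of_nonneg_right (planeSum_increment_ge ρ hρ hN hd hL hx hy hxy) hD.le

/-- ★★ **On every finite torus the mean plaquette is STRICTLY increasing in the coupling on all of `ℝ`** (`G ≅ SU(N)`, `N ≥ 2`, `d ≥ 2`,
`L ≥ 1`, every plaquette). [folklore] -/
theorem strictMono_torusPlaquette (hρ : IsSpecialUnitaryModel ρ) (hN : 2 ≤ N) (hd : 2 ≤ d) {L : ℕ} (hL : 1 ≤ L) (x₀ : Site d (L + 1))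
    {i j : Fin d} (hij : i ≠ j) :
    StrictMono fun β : ℝ =>
      wilsonExpectation (L := L + 1) ρ β (fun U : GaugeConfig d (L + 1) G => (ρ (plaquetteHolonomy U x₀ i j)).trace.re) := by
  intro x y hxy
  set b : ℝ := max |x| |y| with hb
  have hx : x ∈ Set.Icc (-b) b := ⟨by rw [hb]; linarith [neg_abs_le x, le_max_left |x| |y|], (le_abs_self x).trans (le_max_left _ _)⟩
  have hy : y ∈ Set.Icc (-b) b := ⟨by rw [hb]; linarith [neg_abs_le y, le_max_right |x| |y|], (le_abs_self y).trans (le_max_right _ _)⟩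
  have h := plaquette_increment_ge ρ hρ hN hd hL x₀ hij hx hy hxy
  have hD : (0 : ℝ) < (Fintype.card {q : Fin d × Fin d // q.1 < q.2} : ℝ) := by
    have h01 : (⟨0, by omega⟩ : Fin d) < ⟨1, by omega⟩ := Fin.mk_lt_mk.2 (by norm_num)
    have : 0 < Fintype.card {q : Fin d × Fin d // q.1 < q.2} := Fintype.card_pos_iff.2 ⟨⟨(⟨0, by omega⟩, ⟨1, by omega⟩), h01⟩⟩
    exact_mod_cast this
  have hpos : 0 < (1 / 2 : ℝ) ^ d * Real.exp (-(8 * (d - 1 : ℕ) * N * b)) * PlaquetteLowerBound.charVariance ρ * (y - x) /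
      (Fintype.card {q : Fin d × Fin d // q.1 < q.2} : ℝ) :=
    div_pos (mul_pos (mul_pos (mul_pos (by positivity) (Real.exp_pos _))
      (PlaquetteLowerBound.charVariance_pos ρ hρ.1 (by omega))) (sub_pos.2 hxy)) hD
  simp only
  linarith

/-- ★★ **`SU(2)`, `d = 4`, finite volume**: for every `L ≥ 1`, every plaquette `p` of `(ℤ/(L+1)ℤ)⁴` and `−b ≤ x < y ≤ b` (tree coupling):
`⟨Re tr U_p⟩_{Λ,y} − ⟨Re tr U_p⟩_{Λ,x} ≥ e^{−48b} (y − x)/96`. [folklore] -/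
theorem su2_torusPlaquette_increment_ge_dim4 {L : ℕ} (hL : 1 ≤ L) (x₀ : Site 4 (L + 1)) {i j : Fin 4} (hij : i ≠ j) {b x y : ℝ}
    (hx : x ∈ Set.Icc (-b) b) (hy : y ∈ Set.Icc (-b) b) (hxy : x < y) :
    Real.exp (-(48 * b)) * (y - x) / 96 ≤
      wilsonExpectation (L := L + 1) (fundamentalRep (Fin 2)) y
          (fun U : GaugeConfig 4 (L + 1) (Matrix.specialUnitaryGroup (Fin 2) ℂ) =>
            ((fundamentalRep (Fin 2)) (plaquetteHolonomy U x₀ i j)).trace.re) -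
        wilsonExpectation (L := L + 1) (fundamentalRep (Fin 2)) x
          (fun U : GaugeConfig 4 (L + 1) (Matrix.specialUnitaryGroup (Fin 2) ℂ) =>
            ((fundamentalRep (Fin 2)) (plaquetteHolonomy U x₀ i j)).trace.re) := by
  have h := plaquette_increment_ge (d := 4) (fundamentalRep (Fin 2)) (TorusAreaLaw.isSpecialUnitaryModel_fundamentalRep 2) le_rfl
    (by norm_num) hL x₀ hij hx hy hxy
  rw [HaarSecondMoments.charVariance_su2] at h
  have hcard : (Fintype.card {q : Fin 4 × Fin 4 // q.1 < q.2} : ℝ) = 6 := by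
    rw [Fintype.card_subtype]; norm_cast
  rw [hcard] at h
  have e : (1 / 2 : ℝ) ^ 4 * Real.exp (-(8 * (4 - 1 : ℕ) * (2 : ℕ) * b)) * 1 * (y - x) / 6 = Real.exp (-(48 * b)) * (y - x) / 96 := by
    norm_num; ring_nf
  rw [e] at h
  exact h

end EnergyVariance

end Summit.Ventures.YMGap.RobustBall
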